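import Literature.Probability.Percolation.NewmanSchulman
import Literature.Probability.Percolation.InsertionTolerance
import HarnessLib

/-!
# Same-`p` boundary touching: the unique infinite cluster meets every invariant vertex set (lane lemma (F1))

builds on p205010 (kernel theorem, internal audit signed; external expert review pending) — nothing in this file uses p205010.
Lane `prim-bschramm`, seat `prim-bschramm-p4` (gen 2; P4-GENERAL.md §10.2 (F1)), helper file (`--supports stmt-CriticalPhenomena-4575`).

Setting: Bernoulli bond percolation at density `p > 0` on a connected graph `G` with countably many vertices; a family `S`
of automorphisms of `G` that moves every finite vertex set off itself (the ergodicity hypothesis of Newman–Schulman in the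
form the tree uses, `L/NewmanSchulman.lean`); a non-empty vertex set `D` invariant under every member of `S`.
* `bondPercolation_zero_one_of_invariant_family` — zero–one law for measurable events invariant under the FAMILY `S`
  (the tree's `bondPercolation_zero_one_of_autInvariant` asks invariance under all of `Aut(G)`; same proof, adapted);
* **`ae_reachable_invariantSet_of_percolatesAt`** — if the infinite cluster is a.s. unique at `p`, then a.s. EVERY vertex with an
  infinite cluster is joined by an open path to `D`.  Proof: `{∃ infinite cluster avoiding D}` is `S`-invariant hence trivial; if it
  were almost sure, opening a fixed finite path from an avoiding infinite cluster to `D` (insertion tolerance,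
  `bondPercolation_real_pos_of_openEdges`) would produce, with positive probability, an infinite cluster meeting `D` next to one
  avoiding `D` — two infinite clusters;
* `prob_percolatesAt_le_prob_reach_invariantSet` — hence `P_p(x ↔ ∞) ≤ P_p(x ↔ D)`.
USE (P4-GENERAL §10.2): with `G` := the graph INDUCED by an amenable quasi-transitive tube/cylinder `T` of an ambient graph
(uniqueness inside `T` by the tree's Burton–Keane), `S` := the ambient automorphisms preserving `T`, `D := ∂T`: at the SAME density,
a seed percolating in the ambient graph is joined to `∂T` inside `T` a.s. (its `T`-cluster is finite and exits, or is the unique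
infinite `T`-cluster) — so steering towards the boundary of any such tube is free; what is not free is fibre-extent control
(§10.1).  Not claimed to be in print in this form; the method is Lyons–Peres' proof of Newman–Schulman.
[cite: LyonsPeres2016, Prop. 7.3 and Thm. 7.5 (ergodicity, insertion)] [cite: NewmanSchulman1981] [cite: BurtonKeane1989, Thm. 2]
-/

noncomputable section

open MeasureTheory
open scoped symmDiff

namespace Summit.CriticalPhenomena.PercolationContinuityZ3.Theorems.Transplant

open Literature.Probability.Percolation Literature.Probability.LatticeModels SimpleGraph

variable {V : Type*}

/-- **Zero–one law for events invariant under a family of automorphisms moving finite sets off themselves**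
(adapted from the tree's `bondPercolation_zero_one_of_autInvariant`, `L/NewmanSchulman.lean`, which quantifies over all of
`Aut(G)`): approximate `A` by a local event `B`, move its support off itself by some `γ ∈ S`, so that `B` and `γ⁻¹B` are independent
while `γ⁻¹A = A`; then `|P(A) − P(A)²| < 4ε`. [cite: LyonsPeres2016, Prop. 7.3 and Thm. 7.5 (proof)] -/
theorem bondPercolation_zero_one_of_invariant_family [Countable V] (G : SimpleGraph V) (p : unitInterval)
    (S : Set (G ≃g G)) (hfar : ∀ U : Set V, U.Finite → ∃ γ ∈ S, Disjoint ((γ : V → V) '' U) U)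
    {A : Set (BondConfig V)} (hA : MeasurableSet A)
    (hinv : ∀ γ ∈ S, BondConfig.relabel (sym2Equiv γ.toEquiv) ⁻¹' A = A) :
    bondPercolation G p A = 0 ∨ bondPercolation G p A = 1 := by
  set μ := bondPercolation G p with hμ
  -- Step 1: `|μ(A) - μ(A)²| < 4ε` for every `ε > 0`.
  have key : ∀ ε : ℝ, 0 < ε → |μ.real A - μ.real A * μ.real A| < 4 * ε := by
    intro ε hε
    obtain ⟨B, ⟨F, hBF⟩, hBA⟩ :=
      exists_isLocalEvent_measure_symmDiff_lt (μ := μ) hA (ENNReal.ofReal_pos.2 hε)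
    have hBm : MeasurableSet B := measurableSet_of_isLocalEvent_holds ⟨F, hBF⟩
    obtain ⟨γ, hγS, hγ⟩ := hfar _ (finite_biUnion_setOf_mem_sym2 F)
    set e2 : Sym2 V ≃ Sym2 V := sym2Equiv γ.toEquiv with he2
    set T : BondConfig V → BondConfig V := ⇑(BondConfig.relabel e2) with hTdef
    have hT : MeasurePreserving T μ μ :=
      ⟨(BondConfig.relabel e2).measurable, bondPercolation_map_relabel_iso γ p⟩
    have hTA : T ⁻¹' A = A := hinv γ hγS
    have hdisj : Disjoint (↑F : Set (Sym2 V)) (e2.symm '' ↑F) :=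
      disjoint_symm_image_of_disjoint_image γ F hγ
    have hind : μ (B ∩ T ⁻¹' B) = μ B * μ B := by
      rw [hμ, bondPercolation_inter_of_disjoint G p hdisj hBF (hBF.preimage_relabel e2) hBm
        (hT.measurable hBm)]
      congr 1
      exact hT.measure_preimage hBm.nullMeasurableSet
    have hd : μ.real (B ∆ A) < ε := ENNReal.toReal_lt_of_lt_ofReal hBA
    have h1 : |μ.real A - μ.real B| ≤ μ.real (B ∆ A) := by
      rw [symmDiff_comm]
      exact abs_measureReal_sub_le_measureReal_symmDiff hA.nullMeasurableSet hBm.nullMeasurableSet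
    have h2 : |μ.real A - μ.real (B ∩ T ⁻¹' B)| ≤ 2 * μ.real (B ∆ A) := by
      have hpre : μ.real (T ⁻¹' (A ∆ B)) = μ.real (A ∆ B) := by
        simp only [measureReal_def]
        rw [hT.measure_preimage (hA.symmDiff hBm).nullMeasurableSet]
      calc |μ.real A - μ.real (B ∩ T ⁻¹' B)|
          = |μ.real (A ∩ T ⁻¹' A) - μ.real (B ∩ T ⁻¹' B)| := by
            rw [hTA, Set.inter_self]
        _ ≤ μ.real ((A ∩ T ⁻¹' A) ∆ (B ∩ T ⁻¹' B)) :=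
            abs_measureReal_sub_le_measureReal_symmDiff
              (hA.inter (hT.measurable hA)).nullMeasurableSet
              (hBm.inter (hT.measurable hBm)).nullMeasurableSet
        _ ≤ μ.real ((A ∆ B) ∪ T ⁻¹' (A ∆ B)) := by
            refine measureReal_mono ?_
            intro x hx
            simp only [Set.mem_symmDiff, Set.mem_inter_iff, Set.mem_preimage, Set.mem_union] at hx ⊢
            tauto
        _ ≤ μ.real (A ∆ B) + μ.real (T ⁻¹' (A ∆ B)) := measureReal_union_le _ _
        _ = 2 * μ.real (B ∆ A) := by rw [hpre, symmDiff_comm]; ring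
    have h3 : μ.real (B ∩ T ⁻¹' B) = μ.real B * μ.real B := by
      simp only [measureReal_def]; rw [hind, ENNReal.toReal_mul]
    rw [h3] at h2
    have hA0 : 0 ≤ μ.real A := measureReal_nonneg
    have hA1 : μ.real A ≤ 1 := measureReal_le_one
    have hB0 : 0 ≤ μ.real B := measureReal_nonneg
    have hB1 : μ.real B ≤ 1 := measureReal_le_one
    have h4 : |μ.real B * μ.real B - μ.real A * μ.real A| ≤ 2 * μ.real (B ∆ A) := by
      have : μ.real B * μ.real B - μ.real A * μ.real A =
          (μ.real B - μ.real A) * (μ.real B + μ.real A) := by ring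
      rw [this, abs_mul, abs_sub_comm]
      calc |μ.real A - μ.real B| * |μ.real B + μ.real A| ≤ μ.real (B ∆ A) * 2 := by
            refine mul_le_mul h1 ?_ (abs_nonneg _) measureReal_nonneg
            rw [abs_le]; constructor <;> linarith
        _ = 2 * μ.real (B ∆ A) := by ring
    calc |μ.real A - μ.real A * μ.real A|
        ≤ |μ.real A - μ.real B * μ.real B| + |μ.real B * μ.real B - μ.real A * μ.real A| :=
          abs_sub_le _ _ _
      _ ≤ 4 * μ.real (B ∆ A) := by linarith
      _ < 4 * ε := by linarith
  -- Step 2: hence `μ(A) = μ(A)²`, i.e. `μ(A) ∈ {0, 1}`.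
  have ha : μ.real A - μ.real A * μ.real A = 0 := by
    by_contra hne
    have hpos : 0 < |μ.real A - μ.real A * μ.real A| := abs_pos.2 hne
    have := key (|μ.real A - μ.real A * μ.real A| / 4) (by positivity)
    linarith
  have hreal : μ.real A = 0 ∨ μ.real A = 1 := by
    have : μ.real A * (1 - μ.real A) = 0 := by rw [← ha]; ring
    rcases mul_eq_zero.1 this with h | h
    · exact Or.inl h
    · exact Or.inr (by linarith)
  rcases hreal with h | h
  · exact Or.inl ((measureReal_eq_zero_iff (measure_ne_top μ A)).1 h)
  · right
    rw [measureReal_def] at h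
    exact (ENNReal.toReal_eq_one_iff _).1 h

/-- The event "some infinite cluster avoids `D`" is measurable (`V` countable). [folklore] -/
theorem measurableSet_exists_percolatesAt_avoiding [Countable V] (D : Set V) :
    MeasurableSet {ω : BondConfig V | ∃ v, ω ∈ percolatesAt v ∧ ∀ d ∈ D, ¬ (openGraph ω).Reachable v d} := by
  have h : {ω : BondConfig V | ∃ v, ω ∈ percolatesAt v ∧ ∀ d ∈ D, ¬ (openGraph ω).Reachable v d} =
      ⋃ v, (percolatesAt v ∩ ⋂ d ∈ D, {ω : BondConfig V | (openGraph ω).Reachable v d}ᶜ) := by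
    ext ω
    simp only [Set.mem_setOf_eq, Set.mem_iUnion, Set.mem_inter_iff, Set.mem_iInter, Set.mem_compl_iff]
  rw [h]
  exact MeasurableSet.iUnion fun v => (measurableSet_percolatesAt_holds v).inter
    (MeasurableSet.biInter (Set.to_countable D) fun d _ => (measurableSet_setOf_reachable v d).compl)

/-- The event "some infinite cluster meets `D`" is measurable (`V` countable). [folklore] -/
theorem measurableSet_exists_percolatesAt_meeting [Countable V] (D : Set V) :
    MeasurableSet {ω : BondConfig V | ∃ v, ω ∈ percolatesAt v ∧ ∃ d ∈ D, (openGraph ω).Reachable v d} := by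
  have h : {ω : BondConfig V | ∃ v, ω ∈ percolatesAt v ∧ ∃ d ∈ D, (openGraph ω).Reachable v d} =
      ⋃ v, (percolatesAt v ∩ ⋃ d ∈ D, {ω : BondConfig V | (openGraph ω).Reachable v d}) := by
    ext ω
    simp only [Set.mem_setOf_eq, Set.mem_iUnion, Set.mem_inter_iff, exists_prop]
  rw [h]
  exact MeasurableSet.iUnion fun v => (measurableSet_percolatesAt_holds v).inter
    (MeasurableSet.biUnion (Set.to_countable D) fun d _ => measurableSet_setOf_reachable v d)

/-- The event "some infinite cluster avoids `D`" is invariant under automorphisms preserving `D`. [folklore] -/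
theorem preimage_relabel_exists_percolatesAt_avoiding {G : SimpleGraph V} (γ : G ≃g G) {D : Set V}
    (hγD : ∀ v, γ v ∈ D ↔ v ∈ D) :
    BondConfig.relabel (sym2Equiv γ.toEquiv) ⁻¹'
        {ω : BondConfig V | ∃ v, ω ∈ percolatesAt v ∧ ∀ d ∈ D, ¬ (openGraph ω).Reachable v d} =
      {ω : BondConfig V | ∃ v, ω ∈ percolatesAt v ∧ ∀ d ∈ D, ¬ (openGraph ω).Reachable v d} := by
  ext ω
  simp only [Set.mem_preimage, Set.mem_setOf_eq]
  constructor
  · rintro ⟨v, hv, hvd⟩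
    refine ⟨γ.toEquiv.symm v, ?_, fun d hd hr => ?_⟩
    · rw [← relabel_mem_percolatesAt_iff γ.toEquiv, Equiv.apply_symm_apply]
      exact hv
    · refine hvd (γ.toEquiv d) ((hγD d).2 hd) ?_
      have := (reachable_relabel_iff γ.toEquiv ω (γ.toEquiv.symm v) d).2 hr
      rwa [Equiv.apply_symm_apply] at this
  · rintro ⟨v, hv, hvd⟩
    refine ⟨γ.toEquiv v, (relabel_mem_percolatesAt_iff γ.toEquiv ω v).2 hv, fun d hd hr => ?_⟩
    have hd' : γ.toEquiv.symm d ∈ D := by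
      rw [← hγD]
      change γ.toEquiv (γ.toEquiv.symm d) ∈ D
      rwa [Equiv.apply_symm_apply]
    refine hvd (γ.toEquiv.symm d) hd' ?_
    rw [← reachable_relabel_iff γ.toEquiv ω, Equiv.apply_symm_apply]
    exact hr

/-- Two vertices with infinite clusters that are not joined witness `N ≥ 2`. [folklore] -/
theorem two_le_numInfiniteClusters_of_not_reachable [DecidableEq V] {ω : BondConfig V} {x y : V}
    (hx : ω ∈ percolatesAt x) (hy : ω ∈ percolatesAt y) (hxy : ¬ (openGraph ω).Reachable x y) :
    (2 : ℕ∞) ≤ numInfiniteClusters ω := by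
  have hne : x ≠ y := fun h => hxy (h ▸ SimpleGraph.Reachable.refl _)
  have h2 : ω ∈ atLeastInfClusters V 2 := by
    refine ⟨{x, y}, Finset.card_pair hne, ?_, ?_⟩
    · intro v hv
      rcases Finset.mem_insert.1 hv with rfl | hv
      · exact hx
      · rw [Finset.mem_singleton] at hv; subst hv; exact hy
    · intro a ha b hb hab
      rw [Finset.coe_insert, Finset.coe_singleton, Set.mem_insert_iff, Set.mem_singleton_iff] at ha hb
      rcases ha with rfl | rfl <;> rcases hb with rfl | rfl
      · exact absurd rfl hab
      · exact hxy
      · exact fun h => hxy h.symm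
      · exact absurd rfl hab
  have := (mem_atLeastInfClusters_iff ω 2).1 h2
  exact_mod_cast this

/-- **(F1) The unique infinite cluster meets every invariant non-empty vertex set, at the same density.**  On a connected graph
with countably many vertices, at `p > 0`, let `S` be a family of automorphisms moving every finite vertex set off itself and `D` a
non-empty vertex set preserved by every member of `S`.  If the infinite cluster is a.s. unique at `p`, then a.s. every vertex with
an infinite open cluster is joined by an open path to `D`.  (Zero–one law for the `S`-invariant event "some infinite cluster
avoids `D`"; if it were almost sure, inserting a fixed open path from an avoiding cluster to `D` would create two infinite clusters
with positive probability.)  Not claimed to be in print in this form. [cite: LyonsPeres2016, Prop. 7.3 and Thm. 7.5 (method)]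
[cite: BurtonKeane1989, Thm. 2 (uniqueness input)] -/
theorem ae_reachable_invariantSet_of_percolatesAt [Countable V] (G : SimpleGraph V) (hconn : G.Connected)
    {p : unitInterval} (hp : 0 < (p : ℝ)) (S : Set (G ≃g G))
    (hfar : ∀ U : Set V, U.Finite → ∃ γ ∈ S, Disjoint ((γ : V → V) '' U) U)
    (D : Set V) (hD : D.Nonempty) (hSD : ∀ γ ∈ S, ∀ v, γ v ∈ D ↔ v ∈ D)
    (huniq : ∀ᵐ ω ∂(bondPercolation G p), numInfiniteClusters ω ≤ 1) :
    ∀ᵐ ω ∂(bondPercolation G p), ∀ v, ω ∈ percolatesAt v → ∃ d ∈ D, (openGraph ω).Reachable v d := by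
  classical
  set μ := bondPercolation G p with hμ
  set B : Set (BondConfig V) := {ω | ∃ v, ω ∈ percolatesAt v ∧ ∀ d ∈ D, ¬ (openGraph ω).Reachable v d} with hB
  have hBm : MeasurableSet B := measurableSet_exists_percolatesAt_avoiding D
  have h01 : μ B = 0 ∨ μ B = 1 :=
    bondPercolation_zero_one_of_invariant_family G p S hfar hBm fun γ hγ =>
      preimage_relabel_exists_percolatesAt_avoiding γ (hSD γ hγ)
  rcases h01 with h0 | h1
  · filter_upwards [measure_eq_zero_iff_ae_notMem.1 h0] with ω hω v hv
    by_contra hno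
    push Not at hno
    exact hω ⟨v, hv, hno⟩
  · exfalso
    -- `B` holds a.s.; some vertex `v` avoids `D` with an infinite cluster with positive probability
    have hBae : ∀ᵐ ω ∂μ, ω ∈ B := by
      have h0 : μ Bᶜ = 0 := (prob_compl_eq_zero_iff hBm).2 h1
      filter_upwards [measure_eq_zero_iff_ae_notMem.1 h0] with ω hω using Set.notMem_compl_iff.1 hω
    set Bv : V → Set (BondConfig V) := fun v => {ω | ω ∈ percolatesAt v ∧ ∀ d ∈ D, ¬ (openGraph ω).Reachable v d}
      with hBv
    have hpos : ∃ v, 0 < μ.real (Bv v) := by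
      by_contra hno
      push Not at hno
      have h0 : ∀ v, μ (Bv v) = 0 := fun v =>
        (measureReal_eq_zero_iff (measure_ne_top _ _)).1 (le_antisymm (hno v) measureReal_nonneg)
      have hU : μ (⋃ v, Bv v) = 0 := measure_iUnion_null h0
      have hF : ∀ᵐ ω ∂μ, False := by
        filter_upwards [hBae, measure_eq_zero_iff_ae_notMem.1 hU] with ω hω hω'
        obtain ⟨v, hv⟩ := hω
        exact hω' (Set.mem_iUnion.2 ⟨v, hv⟩)
      rw [Filter.eventually_false_iff_eq_bot, ae_eq_bot] at hF
      exact IsProbabilityMeasure.ne_zero μ hF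
    obtain ⟨v, hv⟩ := hpos
    -- insert an open path from `v` to a point of `D`
    obtain ⟨d₀, hd₀⟩ := hD
    obtain ⟨w⟩ := hconn.preconnected v d₀
    set F : Finset (Sym2 V) := w.edges.toFinset with hF
    have hFE : (↑F : Set (Sym2 V)) ⊆ G.edgeSet := by
      intro e he
      simp only [hF, Finset.mem_coe, List.mem_toFinset] at he
      exact w.edges_subset_edgeSet he
    set E : Set (BondConfig V) := {ω | ∃ u, ω ∈ percolatesAt u ∧ ∃ d ∈ D, (openGraph ω).Reachable u d} with hE
    have hEm : MeasurableSet E := measurableSet_exists_percolatesAt_meeting D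
    have hEpos : 0 < μ.real E := by
      refine bondPercolation_real_pos_of_openEdges G hp F hFE hEm hv fun ω hω => ?_
      refine ⟨v, percolatesAt_mono (subset_openEdges _ _) v hω.1, d₀, hd₀, ?_⟩
      refine reachable_openGraph_of_edges_mem w fun e he => subset_openEdges_right _ _ ?_
      simp [hF, he]
    -- on a positive-measure event: an infinite cluster meeting `D`, another avoiding `D`, and `N ≤ 1` — absurd
    have hT : μ {ω | ω ∈ B ∧ numInfiniteClusters ω ≤ 1}ᶜ = 0 := by
      have h : ∀ᵐ ω ∂μ, ω ∈ B ∧ numInfiniteClusters ω ≤ 1 := hBae.and huniq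
      rw [Set.compl_setOf]
      exact ae_iff.1 h
    have hne : μ (E ∩ {ω | ω ∈ B ∧ numInfiniteClusters ω ≤ 1}) ≠ 0 := by
      rw [measure_inter_conull hT]
      intro h0
      rw [measureReal_def, h0, ENNReal.toReal_zero] at hEpos
      exact lt_irrefl _ hEpos
    obtain ⟨ω, ⟨u, hu, d, hd, hud⟩, ⟨v', hv', hv'd⟩, hN⟩ := nonempty_of_measure_ne_zero hne
    by_cases hr : (openGraph ω).Reachable v' u
    · exact hv'd d hd (hr.trans hud)
    · have h2 := two_le_numInfiniteClusters_of_not_reachable hv' hu hr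
      have h21 : (2 : ℕ∞) ≤ 1 := h2.trans hN
      exact absurd h21 (by decide)

/-- **Corollary**: under the same hypotheses, `P_p(x ↔ ∞) ≤ P_p(x ↔ D)` for every vertex `x`.
[cite: LyonsPeres2016, Thm. 7.5 (method)] -/
theorem prob_percolatesAt_le_prob_reach_invariantSet [Countable V] (G : SimpleGraph V) (hconn : G.Connected)
    {p : unitInterval} (hp : 0 < (p : ℝ)) (S : Set (G ≃g G))
    (hfar : ∀ U : Set V, U.Finite → ∃ γ ∈ S, Disjoint ((γ : V → V) '' U) U)
    (D : Set V) (hD : D.Nonempty) (hSD : ∀ γ ∈ S, ∀ v, γ v ∈ D ↔ v ∈ D)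
    (huniq : ∀ᵐ ω ∂(bondPercolation G p), numInfiniteClusters ω ≤ 1) (x : V) :
    (bondPercolation G p).real (percolatesAt x) ≤
      (bondPercolation G p).real {ω | ∃ d ∈ D, (openGraph ω).Reachable x d} := by
  have h : bondPercolation G p (percolatesAt x) ≤ bondPercolation G p {ω | ∃ d ∈ D, (openGraph ω).Reachable x d} := by
    refine measure_mono_ae ?_
    filter_upwards [ae_reachable_invariantSet_of_percolatesAt G hconn hp S hfar D hD hSD huniq] with ω hω hx
    exact hω x hx
  simp only [measureReal_def]
  exact ENNReal.toReal_mono (measure_ne_top _ _) h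

end Summit.CriticalPhenomena.PercolationContinuityZ3.Theorems.Transplant

end
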